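import Literature.Barriers.CriticalPhenomena.RigorousRGSmallParameterLocalPolynomial
import Mathlib.Algebra.Order.Chebyshev
import HarnessLib

/-!
# `RigorousRGSmallParameter` (Slade, Theorem 1.4.1): `‖τ_x‖_{T_φ(𝔥)} ≤ (√τ_x(φ) + √(n/2)𝔥)²`
# ([BS-rg-norm] Proposition 3.5.1 for the real `n`-component field)

Companion ("proof architecture") file of
`Literature/Barriers/CriticalPhenomena/RigorousRGSmallParameter.lean` (estimates layer behind
Theorem 6.3.1 / `Slade2017_prop822`). The stability bounds of [BS-rg-IE] §5 start from
[BS-rg-norm] Proposition 3.5.1, "`‖τ_x‖_{T_φ} = (|φ_x| + 𝔥)² …`" (complex field), combined with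
Proposition 3.4.6 (`‖e^{-F}‖_{T_φ} ≤ e^{-2F(φ)+‖F‖_{T_φ}}`, tree: `TphiNorm_exp_neg_le_lattice`) to
control `‖e^{-gτ_x²}‖_{T_φ}` ([BS-rg-IE] (5.4), (5.9)). The tree had the case `φ = 0`
(`TphiNorm_tau_zero_le`, `TphiNorm_tau_zero_eq`); this file PROVES the bound at a general real
field `φ ∈ (ℝⁿ)^Λ`: the coefficients of `τ_x = ½|φ_x|²` at `φ` are `τ_x(φ)`, `φ_x^i`, `δ_{ij}` on
lengths `0, 1, 2`, and unit-ball test functions satisfy `|g_z| ≤ 𝔥^{|z|}`: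

* `tau_nonneg`, `abs_coeffFamily_tau_le`, `sumSeq_one_site`;
* **`TphiNorm_tau_le`**: `‖τ_x‖_{T_φ(𝔥)} ≤ τ_x(φ) + 𝔥Σ_i|φ_x^i| + ½n𝔥²`;
* `sum_abs_sq_le` (`(Σ_i|φ_x^i|)² ≤ 2nτ_x(φ)`, Cauchy–Schwarz) and **`TphiNorm_tau_le_sq`**:
  `‖τ_x‖_{T_φ(𝔥)} ≤ (√τ_x(φ) + √(n/2)·𝔥)²`.

Sources: D. C. Brydges, G. Slade, *A renormalisation group method. I. Gaussian integration and
normed algebras*, J. Stat. Phys. 159 (2015) 421–460, arXiv:1403.7244, Proposition 3.5.1;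
[BS-rg-IE] arXiv:1403.7255 §5 (use in (5.4)).

## References

* [BrydgesSlade2015RGI] D. C. Brydges, G. Slade, *A renormalisation group method. I*, J. Stat.
  Phys. **159** (2015) 421–460, arXiv:1403.7244.
-/

noncomputable section

namespace Literature.Barriers.CriticalPhenomena

namespace LongRangePhi4

namespace LocalPoly

open Finset Tphi RGNorm Literature.Probability.LatticeModels
open scoped ContDiff

variable {d M n : ℕ} [NeZero M]

omit [NeZero M] in
/-- `τ_x(φ) ≥ 0`. [folklore] -/
theorem tau_nonneg (x : TorusSite d M) (φ : TorusSite d M → Fin n → ℝ) : 0 ≤ tau x φ := by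
  unfold tau
  positivity

/-- The coefficients of `τ_x` at a general field, bounded in absolute value by an explicit majorant
supported on lengths `0, 1, 2`. [folklore] -/
theorem abs_coeffFamily_tau_le (x : TorusSite d M) (φ : TorusSite d M → Fin n → ℝ) (z : List (TorusSite d M × Fin n)) :
    |coeffFamily (basisDir d M n) (tau x) φ z| ≤
      (match z with
      | [] => tau x φ
      | [q] => if q.1 = x then |φ q.1 q.2| else 0
      | [q', q] => if q.1 = x ∧ q = q' then 1 else 0
      | _ => 0) := by
  unfold coeffFamily
  match z with
  | [] => rw [coeff_nil, abs_of_nonneg (tau_nonneg x φ)]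
  | [q] =>
      rw [coeff_tau_one]
      by_cases h : q.1 = x
      · simp [h, ev]
      · simp [h]
  | [q', q] =>
      rw [coeff_tau_two]
      by_cases h : (q.1 = x ∧ q = q')
      · obtain ⟨h1, rfl⟩ := h
        simp [h1]
      · rw [if_neg h]; simp [h]
  | a :: b :: c :: z => rw [coeff_tau_eq_zero x _ (by simp)]; simp

/-- `Σ_q 𝟙_{q.1 = x} |φ_{q}| t = (Σ_i |φ_x^i|) t`. [folklore] -/
theorem sumSeq_one_site (x : TorusSite d M) (φ : TorusSite d M → Fin n → ℝ) (t : ℝ) :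
    sumSeq 1 (fun z : List (TorusSite d M × Fin n) =>
      (match z with
      | [q] => if q.1 = x then |φ q.1 q.2| else 0
      | _ => (0:ℝ)) * t) = (∑ i, |φ x i|) * t := by
  simp only [sumSeq_succ, sumSeq_zero]
  rw [← Finset.sum_mul, Fintype.sum_prod_type]
  congr 1
  rw [Finset.sum_eq_single x]
  · simp
  · intro y _ hy
    simp [hy]
  · intro h; exact absurd (mem_univ _) h

/-- **`‖τ_x‖_{T_φ(𝔥)} ≤ τ_x(φ) + 𝔥 Σ_i|φ_x^i| + ½n𝔥²`** — the real `n`-component analogue of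
[BS-rg-norm] Proposition 3.5.1 ("`‖τ_x‖_{T_φ} = (|φ_x| + 𝔥)² …`"): the coefficients of `τ_x` at `φ`
are `τ_x(φ)` (length `0`), `φ_x^i` (length `1`) and `δ` (length `2`), and test functions in the
unit ball obey `|g_z| ≤ 𝔥^{|z|}`. [cite: BrydgesSlade2015RGI, Proposition 3.5.1] -/
theorem TphiNorm_tau_le {𝔥 R : ℝ} (h𝔥 : 0 < 𝔥) (hR : 0 < R) (pΦ pN : ℕ) (x : TorusSite d M)
    (φ : TorusSite d M → Fin n → ℝ) :
    TphiNorm pN (latticeFamily (unitStep d M) 𝔥 R pΦ) (basisDir d M n) (tau x) φ ≤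
      tau x φ + 𝔥 * ∑ i, |φ x i| + 2⁻¹ * n * 𝔥 ^ 2 := by
  unfold TphiNorm
  refine Tnorm_le fun g hg => ?_
  have hev := latticeFamily_evalBound (unitStep d M) h𝔥 hR pΦ pN (ι := Fin n) g hg
  set ind : List (TorusSite d M × Fin n) → ℝ := fun z =>
    match z with
    | [] => tau x φ
    | [q] => if q.1 = x then |φ q.1 q.2| else 0
    | [q', q] => if q.1 = x ∧ q = q' then (1:ℝ) else 0
    | _ => 0 with hind
  have hind3 : ∀ z : List (TorusSite d M × Fin n), 2 < z.length → ind z = 0 := by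
    intro z hz
    match z, hz with
    | _ :: _ :: _ :: _, _ => rfl
  -- the three contributing lengths
  have hval : ∀ r, ((r.factorial : ℝ)⁻¹) * sumSeq r (fun z => ind z * 𝔥 ^ r) =
      (if r = 0 then tau x φ else 0) + (if r = 1 then 𝔥 * ∑ i, |φ x i| else 0) + (if r = 2 then 2⁻¹ * n * 𝔥 ^ 2 else 0) := by
    intro r
    match r with
    | 0 => simp [hind]
    | 1 =>
        have h := sumSeq_one_site (n := n) x φ (𝔥 ^ 1)
        have e : sumSeq 1 (fun z => ind z * 𝔥 ^ 1) =
            sumSeq 1 (fun z : List (TorusSite d M × Fin n) => (match z with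
              | [q] => if q.1 = x then |φ q.1 q.2| else 0
              | _ => (0:ℝ)) * 𝔥 ^ 1) :=
          sumSeq_congr 1 fun z hz => by
            match z, hz with
            | [q], _ => rfl
        rw [e, h]
        simp [Nat.factorial]
        ring
    | 2 =>
        simp only [show (2:ℕ) ≠ 0 by decide, show (2:ℕ) ≠ 1 by decide, if_false, if_true, zero_add]
        have e2 : sumSeq 2 (fun z => ind z * 𝔥 ^ 2) = n * 𝔥 ^ 2 := by
          simp only [sumSeq_succ, sumSeq_zero, hind]
          have inner : ∀ a : TorusSite d M × Fin n,
              ∑ b : TorusSite d M × Fin n, (if b.1 = x ∧ b = a then (1:ℝ) else 0) * 𝔥 ^ 2 =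
                (if a.1 = x then 1 else 0) * 𝔥 ^ 2 := by
            intro a
            rw [Finset.sum_eq_single a]
            · simp
            · intro b _ hba
              rw [if_neg]; · simp
              rintro ⟨_, h⟩; exact hba h
            · intro h; exact absurd (mem_univ _) h
          simp only [inner]
          rw [← Finset.sum_mul, Fintype.sum_prod_type]
          congr 1
          rw [Finset.sum_comm]
          simp only [Finset.sum_ite_eq', Finset.mem_univ, if_true, Finset.sum_const, Finset.card_univ,
            Fintype.card_fin, nsmul_eq_mul, mul_one]
        rw [e2]
        simp [Nat.factorial]
        ring
    | r + 3 =>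
        rw [if_neg (by omega), if_neg (by omega), if_neg (by omega), add_zero, add_zero,
          sumSeq_congr (r + 3) (g := fun _ => (0:ℝ)) fun z hz => by rw [hind3 z (by omega), zero_mul],
          sumSeq_zero_fun, mul_zero]
  calc |pairing pN (coeffFamily (basisDir d M n) (tau x) φ) g|
      ≤ ∑ r ∈ range (pN + 1), ((r.factorial : ℝ)⁻¹) * sumSeq r (fun z => |coeffFamily (basisDir d M n) (tau x) φ z| * 𝔥 ^ r) :=
        abs_pairing_le pN _ g (fun r => 𝔥 ^ r) (fun z hz => hev z hz)
    _ ≤ ∑ r ∈ range (pN + 1), ((r.factorial : ℝ)⁻¹) * sumSeq r (fun z => ind z * 𝔥 ^ r) := by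
        refine Finset.sum_le_sum fun r _ => mul_le_mul_of_nonneg_left
          (sumSeq_mono r fun z _ => mul_le_mul_of_nonneg_right ?_ (by positivity)) (by positivity)
        exact abs_coeffFamily_tau_le x φ z
    _ = ∑ r ∈ range (pN + 1), ((if r = 0 then tau x φ else 0) + (if r = 1 then 𝔥 * ∑ i, |φ x i| else 0) +
          (if r = 2 then 2⁻¹ * n * 𝔥 ^ 2 else 0)) := Finset.sum_congr rfl fun r _ => hval r
    _ ≤ tau x φ + 𝔥 * ∑ i, |φ x i| + 2⁻¹ * n * 𝔥 ^ 2 := by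
        rw [Finset.sum_add_distrib, Finset.sum_add_distrib, Finset.sum_ite_eq', Finset.sum_ite_eq', Finset.sum_ite_eq']
        have h0 : (0 : ℝ) ≤ tau x φ := tau_nonneg x φ
        have h1 : (0 : ℝ) ≤ 𝔥 * ∑ i, |φ x i| := by positivity
        have h2 : (0 : ℝ) ≤ 2⁻¹ * n * 𝔥 ^ 2 := by positivity
        split_ifs <;> linarith

omit [NeZero M] in
/-- `(Σ_i |φ_x^i|)² ≤ 2n τ_x(φ)` (Cauchy–Schwarz). [folklore] -/
theorem sum_abs_sq_le (x : TorusSite d M) (φ : TorusSite d M → Fin n → ℝ) : (∑ i, |φ x i|) ^ 2 ≤ 2 * n * tau x φ := by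
  have h := sq_sum_le_card_mul_sum_sq (s := (Finset.univ : Finset (Fin n))) (f := fun i => |φ x i|)
  simp only [Finset.card_univ, Fintype.card_fin, sq_abs] at h
  have e : 2 * (n : ℝ) * tau x φ = n * ∑ i, φ x i ^ 2 := by unfold tau; ring
  rw [e]
  exact h

/-- **`‖τ_x‖_{T_φ(𝔥)} ≤ (√τ_x(φ) + √(n/2)·𝔥)²`**, the completed-square form of `TphiNorm_tau_le`.
[cite: BrydgesSlade2015RGI, Proposition 3.5.1] -/
theorem TphiNorm_tau_le_sq {𝔥 R : ℝ} (h𝔥 : 0 < 𝔥) (hR : 0 < R) (pΦ pN : ℕ) (x : TorusSite d M)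
    (φ : TorusSite d M → Fin n → ℝ) :
    TphiNorm pN (latticeFamily (unitStep d M) 𝔥 R pΦ) (basisDir d M n) (tau x) φ ≤
      (Real.sqrt (tau x φ) + Real.sqrt (2⁻¹ * n) * 𝔥) ^ 2 := by
  refine (TphiNorm_tau_le h𝔥 hR pΦ pN x φ).trans ?_
  have hτ := tau_nonneg x φ
  have hn : (0 : ℝ) ≤ 2⁻¹ * n := by positivity
  have hs := sum_abs_sq_le x φ
  have hS : 0 ≤ ∑ i, |φ x i| := by positivity
  -- `Σ|φ| ≤ √(2nτ) = 2 √τ √(n/2)`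
  have hmid : ∑ i, |φ x i| ≤ 2 * (Real.sqrt (tau x φ) * Real.sqrt (2⁻¹ * n)) := by
    have e : (2 * (Real.sqrt (tau x φ) * Real.sqrt (2⁻¹ * n))) ^ 2 = 2 * n * tau x φ := by
      rw [mul_pow, mul_pow, Real.sq_sqrt hτ, Real.sq_sqrt hn]; ring
    have h2 : (∑ i, |φ x i|) ^ 2 ≤ (2 * (Real.sqrt (tau x φ) * Real.sqrt (2⁻¹ * n))) ^ 2 := by rw [e]; exact hs
    exact (pow_le_pow_iff_left₀ hS (by positivity) two_ne_zero).1 h2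
  calc tau x φ + 𝔥 * ∑ i, |φ x i| + 2⁻¹ * n * 𝔥 ^ 2
      ≤ tau x φ + 𝔥 * (2 * (Real.sqrt (tau x φ) * Real.sqrt (2⁻¹ * n))) + 2⁻¹ * n * 𝔥 ^ 2 := by
        gcongr
    _ = (Real.sqrt (tau x φ) + Real.sqrt (2⁻¹ * n) * 𝔥) ^ 2 := by
        rw [add_sq, Real.sq_sqrt hτ, mul_pow, Real.sq_sqrt hn]; ring

end LocalPoly

end LongRangePhi4

end Literature.Barriers.CriticalPhenomena
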